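import Mathlib
import HarnessLib

/-!
# High-scale certificate for the conformal kernel domination — polynomial cells (aux file of `stub_certHigh`)

Auxiliary file 1/2 of the registered stub `stub_certHigh` (line `conformal-kernel-domination`, crux
`Summit.SmoothPoincare4.SmoothPoincare4.Theses.CylinderEntropy.SliceIsolation`, item stmt-SmoothPoincare4-7632); the
certificate itself is `CylinderEntropySliceIsolationStubCertHigh.lean`.  In its normalised variables
(`ρ = e^{2u}/(8T)`, `x = √ρ`, dipole size `b = √(2/T) ≤ 1/7`) the pulled-back kernel is `Λ₄ G(ρ) e^{−1/4T} e^{bxs}`,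
`G(ρ) = ρ² e^{2−2ρ}`, and the certificate is the flat atom `Λ₄ (509/500 − (161/50) b)` plus ONE cylinder kernel of
weight `Λ₄ (161/50) b`, scale `log 2`, centre `½ log(8T)`, height factor `E(ρ) = exp(−(log ρ)²/(16 log 2))`.  After the
`s`-reduction and concavity in `b` done there, the domination reduces to THREE one-variable inequalities at `b = 1/7`
(`helper_certHighConds`, the registered helper sub-goal of this file): for `0 < ρ ≤ 3`,
`G (1 ± x/7 + 5ρ/441) ≤ 279/500 + (23/50) Q(±1) E` (`Q(1) = 16973/12800`, `Q(−1) = 8973/12800`) and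
`G ≤ 279/500 + (23/50)(Q₀ − Q₂) E` (`Q₀ − Q₂ = 25071/25600`), `Q` being the quadratic minorant of `𝔥(log 2, ·)`.
They are proved cell by cell (`[0, 3/10], [3/10, 1/2], [1/2, 1], [1, 2], [2, 3]`) from elementary bounds anchored at
the peak `ρ = 1`: `ρ(3−ρ)/2 ≤ √ρ ≤ (1+ρ)/2`; `eᵗ ≤ 1 + t + t²/2 + (2/9)t³` on `[0, 1]` (`Real.exp_bound'`) for `ρ ≤ 1`,
`eᵗ ≥ 1 + t + t²/2 + t³/6` (`t ≥ 0`) for `ρ ≥ 1`, `e ≤ 2.718281829`; `E ≥ 1 − (log ρ)²/(16 log 2)`, `log 2 ≥ 9/13`,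
`(log ρ)² ≤ (ρ⁻¹ − 1)²` (`ρ ≤ 1`), `≤ (ρ − 1)²` (`ρ ≥ 1`).  Each cell is then a polynomial inequality with rational
coefficients, closed by `linarith` from the products `(ρ − a)ⁱ (b − ρ)ʲ ≥ 0` (its Bernstein coefficients on the cell are
positive; minimal slack `0.0027`).  No definitions, no named facts.
-/

noncomputable section

-- the registered namespace `Summit.SmoothPoincare4.SmoothPoincare4.Theorems…` repeats a component
set_option linter.dupNamespace false

namespace Summit.SmoothPoincare4.SmoothPoincare4.Theorems.CylinderEntropySliceIsolation

/-! ### The thirteen polynomial cells -/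

/-- Cell `0 ≤ ρ ≤ 3/10` (height Gaussian dropped), `s = +1` condition: a polynomial inequality,
certified by its Bernstein coefficients on the cell. [folklore] -/
theorem certHigh_A1p (ρ : ℝ) (h1 : 0 ≤ ρ) (h2 : ρ ≤ 3 / 10) :
    2718281829 / 1000000000 * ρ ^ 2 *
      (1 + (1 - 2 * ρ) + (1 - 2 * ρ) ^ 2 / 2 + 2 / 9 * (1 - 2 * ρ) ^ 3) * (1 + (1 + ρ) / 14 + 5 * ρ / 441) ≤
      279 / 500 := by
  have ha : (0 : ℝ) ≤ ρ - 0 := by linarith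
  have hb : (0 : ℝ) ≤ 3 / 10 - ρ := by linarith
  linarith [pow_nonneg hb 6, mul_nonneg (pow_nonneg ha 1) (pow_nonneg hb 5),
    mul_nonneg (pow_nonneg ha 2) (pow_nonneg hb 4), mul_nonneg (pow_nonneg ha 3) (pow_nonneg hb 3),
    mul_nonneg (pow_nonneg ha 4) (pow_nonneg hb 2), mul_nonneg (pow_nonneg ha 5) (pow_nonneg hb 1),
    pow_nonneg ha 6]

/-- Cell `0 ≤ ρ ≤ 3/10` (height Gaussian dropped), `s = −1` condition: a polynomial inequality,
certified by its Bernstein coefficients on the cell. [folklore] -/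
theorem certHigh_A1m (ρ : ℝ) (h1 : 0 ≤ ρ) (h2 : ρ ≤ 3 / 10) :
    2718281829 / 1000000000 * ρ ^ 2 *
      (1 + (1 - 2 * ρ) + (1 - 2 * ρ) ^ 2 / 2 + 2 / 9 * (1 - 2 * ρ) ^ 3) * (1 - ρ * (3 - ρ) / 14 + 5 * ρ / 441) ≤
      279 / 500 := by
  have ha : (0 : ℝ) ≤ ρ - 0 := by linarith
  have hb : (0 : ℝ) ≤ 3 / 10 - ρ := by linarith
  linarith [pow_nonneg hb 7, mul_nonneg (pow_nonneg ha 1) (pow_nonneg hb 6),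
    mul_nonneg (pow_nonneg ha 2) (pow_nonneg hb 5), mul_nonneg (pow_nonneg ha 3) (pow_nonneg hb 4),
    mul_nonneg (pow_nonneg ha 4) (pow_nonneg hb 3), mul_nonneg (pow_nonneg ha 5) (pow_nonneg hb 2),
    mul_nonneg (pow_nonneg ha 6) (pow_nonneg hb 1), pow_nonneg ha 7]

/-- Cell `0 ≤ ρ ≤ 3/10` (height Gaussian dropped), centre condition: a polynomial inequality,
certified by its Bernstein coefficients on the cell. [folklore] -/
theorem certHigh_A10 (ρ : ℝ) (h1 : 0 ≤ ρ) (h2 : ρ ≤ 3 / 10) :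
    2718281829 / 1000000000 * ρ ^ 2 *
      (1 + (1 - 2 * ρ) + (1 - 2 * ρ) ^ 2 / 2 + 2 / 9 * (1 - 2 * ρ) ^ 3) ≤
      279 / 500 := by
  have ha : (0 : ℝ) ≤ ρ - 0 := by linarith
  have hb : (0 : ℝ) ≤ 3 / 10 - ρ := by linarith
  linarith [pow_nonneg hb 5, mul_nonneg (pow_nonneg ha 1) (pow_nonneg hb 4),
    mul_nonneg (pow_nonneg ha 2) (pow_nonneg hb 3), mul_nonneg (pow_nonneg ha 3) (pow_nonneg hb 2),
    mul_nonneg (pow_nonneg ha 4) (pow_nonneg hb 1), pow_nonneg ha 5]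

/-- Cell `3/10 ≤ ρ ≤ 1/2` (height Gaussian `≥ 659/1296`), `s = +1` condition. [folklore] -/
theorem certHigh_A2p (ρ : ℝ) (h1 : 3 / 10 ≤ ρ) (h2 : ρ ≤ 1 / 2) :
    2718281829 / 1000000000 * ρ ^ 2 *
      (1 + (1 - 2 * ρ) + (1 - 2 * ρ) ^ 2 / 2 + 2 / 9 * (1 - 2 * ρ) ^ 3) * (1 + (1 + ρ) / 14 + 5 * ρ / 441) ≤
      279 / 500 + 23 / 50 * (16973 / 12800) * (659 / 1296) := by
  have ha : (0 : ℝ) ≤ ρ - 3 / 10 := by linarith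
  have hb : (0 : ℝ) ≤ 1 / 2 - ρ := by linarith
  linarith [pow_nonneg hb 6, mul_nonneg (pow_nonneg ha 1) (pow_nonneg hb 5),
    mul_nonneg (pow_nonneg ha 2) (pow_nonneg hb 4), mul_nonneg (pow_nonneg ha 3) (pow_nonneg hb 3),
    mul_nonneg (pow_nonneg ha 4) (pow_nonneg hb 2), mul_nonneg (pow_nonneg ha 5) (pow_nonneg hb 1),
    pow_nonneg ha 6]

/-- Cell `3/10 ≤ ρ ≤ 1/2` (height Gaussian `≥ 659/1296`), `s = −1` condition. [folklore] -/
theorem certHigh_A2m (ρ : ℝ) (h1 : 3 / 10 ≤ ρ) (h2 : ρ ≤ 1 / 2) :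
    2718281829 / 1000000000 * ρ ^ 2 *
      (1 + (1 - 2 * ρ) + (1 - 2 * ρ) ^ 2 / 2 + 2 / 9 * (1 - 2 * ρ) ^ 3) * (1 - ρ * (3 - ρ) / 14 + 5 * ρ / 441) ≤
      279 / 500 + 23 / 50 * (8973 / 12800) * (659 / 1296) := by
  have ha : (0 : ℝ) ≤ ρ - 3 / 10 := by linarith
  have hb : (0 : ℝ) ≤ 1 / 2 - ρ := by linarith
  linarith [pow_nonneg hb 7, mul_nonneg (pow_nonneg ha 1) (pow_nonneg hb 6),
    mul_nonneg (pow_nonneg ha 2) (pow_nonneg hb 5), mul_nonneg (pow_nonneg ha 3) (pow_nonneg hb 4),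
    mul_nonneg (pow_nonneg ha 4) (pow_nonneg hb 3), mul_nonneg (pow_nonneg ha 5) (pow_nonneg hb 2),
    mul_nonneg (pow_nonneg ha 6) (pow_nonneg hb 1), pow_nonneg ha 7]

/-- Cell `3/10 ≤ ρ ≤ 1/2` (height Gaussian `≥ 659/1296`), centre condition. [folklore] -/
theorem certHigh_A20 (ρ : ℝ) (h1 : 3 / 10 ≤ ρ) (h2 : ρ ≤ 1 / 2) :
    2718281829 / 1000000000 * ρ ^ 2 *
      (1 + (1 - 2 * ρ) + (1 - 2 * ρ) ^ 2 / 2 + 2 / 9 * (1 - 2 * ρ) ^ 3) ≤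
      279 / 500 + 23 / 50 * (25071 / 25600) * (659 / 1296) := by
  have ha : (0 : ℝ) ≤ ρ - 3 / 10 := by linarith
  have hb : (0 : ℝ) ≤ 1 / 2 - ρ := by linarith
  linarith [pow_nonneg hb 5, mul_nonneg (pow_nonneg ha 1) (pow_nonneg hb 4),
    mul_nonneg (pow_nonneg ha 2) (pow_nonneg hb 3), mul_nonneg (pow_nonneg ha 3) (pow_nonneg hb 2),
    mul_nonneg (pow_nonneg ha 4) (pow_nonneg hb 1), pow_nonneg ha 5]

/-- Cell `1/2 ≤ ρ ≤ 1` (`e^{2−2ρ}` by its cubic Taylor bound, `(log ρ)² ≤ 4(1−ρ)²`), `s = +1`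
condition. [folklore] -/
theorem certHigh_Bp (ρ : ℝ) (h1 : 1 / 2 ≤ ρ) (h2 : ρ ≤ 1) :
    ρ ^ 2 * (1 + (2 * (1 - ρ)) + (2 * (1 - ρ)) ^ 2 / 2 + 2 / 9 * (2 * (1 - ρ)) ^ 3) * (1 + (1 + ρ) / 14 + 5 * ρ / 441) ≤
      279 / 500 + 23 / 50 * (16973 / 12800) * (1 - 13 / 36 * (1 - ρ) ^ 2) := by
  have ha : (0 : ℝ) ≤ ρ - 1 / 2 := by linarith
  have hb : (0 : ℝ) ≤ 1 - ρ := by linarith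
  linarith [pow_nonneg hb 6, mul_nonneg (pow_nonneg ha 1) (pow_nonneg hb 5),
    mul_nonneg (pow_nonneg ha 2) (pow_nonneg hb 4), mul_nonneg (pow_nonneg ha 3) (pow_nonneg hb 3),
    mul_nonneg (pow_nonneg ha 4) (pow_nonneg hb 2), mul_nonneg (pow_nonneg ha 5) (pow_nonneg hb 1),
    pow_nonneg ha 6]

/-- Cell `1/2 ≤ ρ ≤ 1` (`e^{2−2ρ}` by its cubic Taylor bound, `(log ρ)² ≤ 4(1−ρ)²`), `s = −1`
condition. [folklore] -/
theorem certHigh_Bm (ρ : ℝ) (h1 : 1 / 2 ≤ ρ) (h2 : ρ ≤ 1) :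
    ρ ^ 2 * (1 + (2 * (1 - ρ)) + (2 * (1 - ρ)) ^ 2 / 2 + 2 / 9 * (2 * (1 - ρ)) ^ 3) * (1 - ρ * (3 - ρ) / 14 + 5 * ρ / 441) ≤
      279 / 500 + 23 / 50 * (8973 / 12800) * (1 - 13 / 36 * (1 - ρ) ^ 2) := by
  have ha : (0 : ℝ) ≤ ρ - 1 / 2 := by linarith
  have hb : (0 : ℝ) ≤ 1 - ρ := by linarith
  linarith [pow_nonneg hb 7, mul_nonneg (pow_nonneg ha 1) (pow_nonneg hb 6),
    mul_nonneg (pow_nonneg ha 2) (pow_nonneg hb 5), mul_nonneg (pow_nonneg ha 3) (pow_nonneg hb 4),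
    mul_nonneg (pow_nonneg ha 4) (pow_nonneg hb 3), mul_nonneg (pow_nonneg ha 5) (pow_nonneg hb 2),
    mul_nonneg (pow_nonneg ha 6) (pow_nonneg hb 1), pow_nonneg ha 7]

/-- Cell `1/2 ≤ ρ ≤ 1` (`e^{2−2ρ}` by its cubic Taylor bound, `(log ρ)² ≤ 4(1−ρ)²`), centre
condition. [folklore] -/
theorem certHigh_B0 (ρ : ℝ) (h1 : 1 / 2 ≤ ρ) (h2 : ρ ≤ 1) :
    ρ ^ 2 * (1 + (2 * (1 - ρ)) + (2 * (1 - ρ)) ^ 2 / 2 + 2 / 9 * (2 * (1 - ρ)) ^ 3) ≤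
      279 / 500 + 23 / 50 * (25071 / 25600) * (1 - 13 / 36 * (1 - ρ) ^ 2) := by
  have ha : (0 : ℝ) ≤ ρ - 1 / 2 := by linarith
  have hb : (0 : ℝ) ≤ 1 - ρ := by linarith
  linarith [pow_nonneg hb 5, mul_nonneg (pow_nonneg ha 1) (pow_nonneg hb 4),
    mul_nonneg (pow_nonneg ha 2) (pow_nonneg hb 3), mul_nonneg (pow_nonneg ha 3) (pow_nonneg hb 2),
    mul_nonneg (pow_nonneg ha 4) (pow_nonneg hb 1), pow_nonneg ha 5]

/-- Cell `1 ≤ ρ ≤ 2` (`e^{2ρ−2} ≥` its cubic Taylor polynomial, `(log ρ)² ≤ (ρ−1)²`), `s = +1`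
condition. [folklore] -/
theorem certHigh_C1p (ρ : ℝ) (h1 : 1 ≤ ρ) (h2 : ρ ≤ 2) :
    ρ ^ 2 * (1 + (1 + ρ) / 14 + 5 * ρ / 441) ≤
      (279 / 500 + 23 / 50 * (16973 / 12800) * (1 - 13 / 144 * (ρ - 1) ^ 2)) *
        (1 + (2 * (ρ - 1)) + (2 * (ρ - 1)) ^ 2 / 2 + (2 * (ρ - 1)) ^ 3 / 6) := by
  have ha : (0 : ℝ) ≤ ρ - 1 := by linarith
  have hb : (0 : ℝ) ≤ 2 - ρ := by linarith
  linarith [pow_nonneg hb 5, mul_nonneg (pow_nonneg ha 1) (pow_nonneg hb 4),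
    mul_nonneg (pow_nonneg ha 2) (pow_nonneg hb 3), mul_nonneg (pow_nonneg ha 3) (pow_nonneg hb 2),
    mul_nonneg (pow_nonneg ha 4) (pow_nonneg hb 1), pow_nonneg ha 5]

/-- Cell `2 ≤ ρ ≤ 3` (`e^{2ρ−2} ≥` its cubic Taylor polynomial, `(log ρ)² ≤ (ρ−1)²`), `s = +1`
condition. [folklore] -/
theorem certHigh_C2p (ρ : ℝ) (h1 : 2 ≤ ρ) (h2 : ρ ≤ 3) :
    ρ ^ 2 * (1 + (1 + ρ) / 14 + 5 * ρ / 441) ≤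
      (279 / 500 + 23 / 50 * (16973 / 12800) * (1 - 13 / 144 * (ρ - 1) ^ 2)) *
        (1 + (2 * (ρ - 1)) + (2 * (ρ - 1)) ^ 2 / 2 + (2 * (ρ - 1)) ^ 3 / 6) := by
  have ha : (0 : ℝ) ≤ ρ - 2 := by linarith
  have hb : (0 : ℝ) ≤ 3 - ρ := by linarith
  linarith [pow_nonneg hb 5, mul_nonneg (pow_nonneg ha 1) (pow_nonneg hb 4),
    mul_nonneg (pow_nonneg ha 2) (pow_nonneg hb 3), mul_nonneg (pow_nonneg ha 3) (pow_nonneg hb 2),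
    mul_nonneg (pow_nonneg ha 4) (pow_nonneg hb 1), pow_nonneg ha 5]

/-- Cell `1 ≤ ρ ≤ 3` (`e^{2ρ−2} ≥` its cubic Taylor polynomial, `(log ρ)² ≤ (ρ−1)²`), `s = −1`
condition. [folklore] -/
theorem certHigh_Cm (ρ : ℝ) (h1 : 1 ≤ ρ) (h2 : ρ ≤ 3) :
    ρ ^ 2 * (1 - ρ * (3 - ρ) / 14 + 5 * ρ / 441) ≤
      (279 / 500 + 23 / 50 * (8973 / 12800) * (1 - 13 / 144 * (ρ - 1) ^ 2)) *
        (1 + (2 * (ρ - 1)) + (2 * (ρ - 1)) ^ 2 / 2 + (2 * (ρ - 1)) ^ 3 / 6) := by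
  have ha : (0 : ℝ) ≤ ρ - 1 := by linarith
  have hb : (0 : ℝ) ≤ 3 - ρ := by linarith
  linarith [pow_nonneg hb 5, mul_nonneg (pow_nonneg ha 1) (pow_nonneg hb 4),
    mul_nonneg (pow_nonneg ha 2) (pow_nonneg hb 3), mul_nonneg (pow_nonneg ha 3) (pow_nonneg hb 2),
    mul_nonneg (pow_nonneg ha 4) (pow_nonneg hb 1), pow_nonneg ha 5]

/-- Cell `1 ≤ ρ ≤ 3` (`e^{2ρ−2} ≥` its cubic Taylor polynomial, `(log ρ)² ≤ (ρ−1)²`), centre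
condition. [folklore] -/
theorem certHigh_C0 (ρ : ℝ) (h1 : 1 ≤ ρ) (h2 : ρ ≤ 3) :
    ρ ^ 2 ≤
      (279 / 500 + 23 / 50 * (25071 / 25600) * (1 - 13 / 144 * (ρ - 1) ^ 2)) *
        (1 + (2 * (ρ - 1)) + (2 * (ρ - 1)) ^ 2 / 2 + (2 * (ρ - 1)) ^ 3 / 6) := by
  have ha : (0 : ℝ) ≤ ρ - 1 := by linarith
  have hb : (0 : ℝ) ≤ 3 - ρ := by linarith
  linarith [pow_nonneg hb 5, mul_nonneg (pow_nonneg ha 1) (pow_nonneg hb 4),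
    mul_nonneg (pow_nonneg ha 2) (pow_nonneg hb 3), mul_nonneg (pow_nonneg ha 3) (pow_nonneg hb 2),
    mul_nonneg (pow_nonneg ha 4) (pow_nonneg hb 1), pow_nonneg ha 5]

/-! ### Elementary bounds and the three conditions on `0 < ρ ≤ 3` -/

/-- Region `ρ ≤ 1/2`: `e^{2−2ρ} = e · e^{1−2ρ} ≤ 2.718281829 · (1 + x + x²/2 + (2/9)x³)`, `x = 1 − 2ρ`.
[folklore] -/
theorem certHigh_expA {ρ : ℝ} (h0 : 0 ≤ ρ) (h1 : ρ ≤ 1 / 2) :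
    Real.exp (2 - 2 * ρ) ≤ 2718281829 / 1000000000 *
      (1 + (1 - 2 * ρ) + (1 - 2 * ρ) ^ 2 / 2 + 2 / 9 * (1 - 2 * ρ) ^ 3) := by
  have hsplit : Real.exp (2 - 2 * ρ) = Real.exp 1 * Real.exp (1 - 2 * ρ) := by
    rw [← Real.exp_add]; ring_nf
  have he : Real.exp 1 ≤ 2718281829 / 1000000000 := by
    have := Real.exp_one_lt_d9; norm_num at this ⊢; linarith
  have hu := Real.exp_bound' (x := 1 - 2 * ρ) (by linarith) (by linarith) (n := 3) (by norm_num)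
  simp only [Finset.sum_range_succ, Finset.sum_range_zero, Nat.factorial] at hu
  norm_num at hu
  have hU : Real.exp (1 - 2 * ρ) ≤
      1 + (1 - 2 * ρ) + (1 - 2 * ρ) ^ 2 / 2 + 2 / 9 * (1 - 2 * ρ) ^ 3 := by
    nlinarith [hu]
  rw [hsplit]
  have hU0 : 0 ≤ 1 + (1 - 2 * ρ) + (1 - 2 * ρ) ^ 2 / 2 + 2 / 9 * (1 - 2 * ρ) ^ 3 := by
    nlinarith
  exact mul_le_mul he hU (Real.exp_pos _).le (by norm_num)

/-- Region `1/2 ≤ ρ ≤ 1`: `e^{2−2ρ} ≤ 1 + x + x²/2 + (2/9)x³`, `x = 2(1 − ρ)`. [folklore] -/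
theorem certHigh_expB {ρ : ℝ} (h0 : 1 / 2 ≤ ρ) (h1 : ρ ≤ 1) :
    Real.exp (2 - 2 * ρ) ≤
      1 + 2 * (1 - ρ) + (2 * (1 - ρ)) ^ 2 / 2 + 2 / 9 * (2 * (1 - ρ)) ^ 3 := by
  have hu := Real.exp_bound' (x := 2 - 2 * ρ) (by linarith) (by linarith) (n := 3) (by norm_num)
  simp only [Finset.sum_range_succ, Finset.sum_range_zero, Nat.factorial] at hu
  norm_num at hu
  nlinarith [hu]

/-- Region `ρ ≥ 1`: `1 + y + y²/2 + y³/6 ≤ e^{y}` at `y = 2(ρ − 1)`. [folklore] -/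
theorem certHigh_expC {ρ : ℝ} (h0 : 1 ≤ ρ) :
    1 + 2 * (ρ - 1) + (2 * (ρ - 1)) ^ 2 / 2 + (2 * (ρ - 1)) ^ 3 / 6 ≤ Real.exp (2 * (ρ - 1)) := by
  have h := Real.sum_le_exp_of_nonneg (x := 2 * (ρ - 1)) (by linarith) 4
  simp only [Finset.sum_range_succ, Finset.sum_range_zero, Nat.factorial] at h
  norm_num at h
  linarith [h]

/-- Lower bound for the height Gaussian of the atom: `1 − (13/144) M ≤ exp(−(log ρ)²/(16 log 2))`
whenever `(log ρ)² ≤ M` (`log 2 ≥ 9/13`, `1 + y ≤ e^y`). [folklore] -/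
theorem certHigh_Elow {ρ M : ℝ} (hM : Real.log ρ ^ 2 ≤ M) :
    1 - 13 / 144 * M ≤ Real.exp (-Real.log ρ ^ 2 / (16 * Real.log 2)) := by
  have hL : 9 / 13 ≤ Real.log 2 := by
    have := Real.log_two_gt_d9; norm_num at this ⊢; linarith
  have h1 : Real.log ρ ^ 2 / (16 * Real.log 2) ≤ 13 / 144 * M := by
    rw [div_le_iff₀ (by positivity)]
    nlinarith [sq_nonneg (Real.log ρ)]
  have h2 : -(Real.log ρ ^ 2 / (16 * Real.log 2)) + 1 ≤
      Real.exp (-Real.log ρ ^ 2 / (16 * Real.log 2)) := by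
    rw [neg_div]; exact Real.add_one_le_exp _
  linarith

/-- For `ρ ≤ 1`: `(log ρ)² ≤ (ρ⁻¹ − 1)²`. [folklore] -/
theorem certHigh_log_sq_le_inv {ρ : ℝ} (hρ : 0 < ρ) (hρ1 : ρ ≤ 1) :
    Real.log ρ ^ 2 ≤ (ρ⁻¹ - 1) ^ 2 := by
  have hlog1 : 0 ≤ -Real.log ρ := by linarith [Real.log_nonpos hρ.le hρ1]
  have hlog2 : -Real.log ρ ≤ ρ⁻¹ - 1 := by
    have := Real.log_le_sub_one_of_pos (inv_pos.2 hρ)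
    rw [Real.log_inv] at this; linarith
  nlinarith

/-- The two algebraic replacements of `x = √ρ` (`x ≤ (1+ρ)/2`, `x ≥ ρ(3−ρ)/2`) inside the dipole
factors, and the positivity of the resulting polynomial factors. [folklore] -/
theorem certHigh_Pbounds {ρ x G : ℝ} (hG0 : 0 ≤ G) (hx : 0 ≤ x) (hxρ : x ^ 2 = ρ) :
    G * (1 + x / 7 + 5 / 441 * ρ) ≤ G * (1 + (1 + ρ) / 14 + 5 * ρ / 441) ∧
      G * (1 - x / 7 + 5 / 441 * ρ) ≤ G * (1 - ρ * (3 - ρ) / 14 + 5 * ρ / 441) ∧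
      (0 : ℝ) ≤ 1 + (1 + ρ) / 14 + 5 * ρ / 441 ∧ (0 : ℝ) ≤ 1 - ρ * (3 - ρ) / 14 + 5 * ρ / 441 := by
  have hρ0 : 0 ≤ ρ := by rw [← hxρ]; positivity
  have hxup : x ≤ (1 + ρ) / 2 := by nlinarith [sq_nonneg (x - 1)]
  have hxlo : ρ * (3 - ρ) / 2 ≤ x := by
    nlinarith [mul_nonneg (mul_nonneg hx (sq_nonneg (x - 1))) (show (0 : ℝ) ≤ x + 2 by linarith)]
  refine ⟨mul_le_mul_of_nonneg_left (by linarith) hG0, mul_le_mul_of_nonneg_left (by linarith) hG0,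
    by positivity, by nlinarith [sq_nonneg (ρ - 3 / 2)]⟩

/-- Region A (`0 < ρ ≤ 1/2`) of `helper_certHighConds`. [folklore] -/
theorem certHigh_condsA {ρ x : ℝ} (hρ : 0 < ρ) (hρh : ρ ≤ 1 / 2) (hx : 0 ≤ x) (hxρ : x ^ 2 = ρ) :
    ρ ^ 2 * Real.exp (2 - 2 * ρ) * (1 + x / 7 + 5 / 441 * ρ) ≤
        279 / 500 + 23 / 50 * (16973 / 12800) * Real.exp (-Real.log ρ ^ 2 / (16 * Real.log 2)) ∧
      ρ ^ 2 * Real.exp (2 - 2 * ρ) * (1 - x / 7 + 5 / 441 * ρ) ≤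
        279 / 500 + 23 / 50 * (8973 / 12800) * Real.exp (-Real.log ρ ^ 2 / (16 * Real.log 2)) ∧
      ρ ^ 2 * Real.exp (2 - 2 * ρ) ≤
        279 / 500 + 23 / 50 * (25071 / 25600) * Real.exp (-Real.log ρ ^ 2 / (16 * Real.log 2)) := by
  set G := ρ ^ 2 * Real.exp (2 - 2 * ρ) with hG
  set E := Real.exp (-Real.log ρ ^ 2 / (16 * Real.log 2)) with hE
  have hG0 : 0 ≤ G := by positivity
  have hE0 : 0 ≤ E := (Real.exp_pos _).le
  obtain ⟨hPp, hPm, hPp0, hPm0⟩ := certHigh_Pbounds hG0 hx hxρ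
  have hGA : G ≤ 2718281829 / 1000000000 * ρ ^ 2 *
      (1 + (1 - 2 * ρ) + (1 - 2 * ρ) ^ 2 / 2 + 2 / 9 * (1 - 2 * ρ) ^ 3) := by
    have := mul_le_mul_of_nonneg_left (certHigh_expA hρ.le hρh) (sq_nonneg ρ); linarith
  have h1 := mul_le_mul_of_nonneg_right hGA hPp0
  have h2 := mul_le_mul_of_nonneg_right hGA hPm0
  rcases le_or_gt ρ (3 / 10) with hρt | hρt
  · exact ⟨by linarith only [hPp, h1, certHigh_A1p ρ hρ.le hρt, hE0],
      by linarith only [hPm, h2, certHigh_A1m ρ hρ.le hρt, hE0],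
      by linarith only [hGA, certHigh_A10 ρ hρ.le hρt, hE0]⟩
  · have hinv : ρ⁻¹ ≤ 10 / 3 := by rw [inv_le_comm₀ hρ (by norm_num)]; linarith
    have hinv1 : 1 ≤ ρ⁻¹ := one_le_inv_iff₀.2 ⟨hρ, by linarith⟩
    have hEA : 659 / 1296 ≤ E :=
      le_trans (by norm_num) (certHigh_Elow ((certHigh_log_sq_le_inv hρ (by linarith)).trans
        (show (ρ⁻¹ - 1) ^ 2 ≤ (7 / 3) ^ 2 by nlinarith)))
    exact ⟨by linarith only [hPp, h1, certHigh_A2p ρ hρt.le hρh, hEA],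
      by linarith only [hPm, h2, certHigh_A2m ρ hρt.le hρh, hEA],
      by linarith only [hGA, certHigh_A20 ρ hρt.le hρh, hEA]⟩

/-- Region B (`1/2 ≤ ρ ≤ 1`) of `helper_certHighConds`. [folklore] -/
theorem certHigh_condsB {ρ x : ℝ} (hρh : 1 / 2 ≤ ρ) (hρ1 : ρ ≤ 1) (hx : 0 ≤ x) (hxρ : x ^ 2 = ρ) :
    ρ ^ 2 * Real.exp (2 - 2 * ρ) * (1 + x / 7 + 5 / 441 * ρ) ≤
        279 / 500 + 23 / 50 * (16973 / 12800) * Real.exp (-Real.log ρ ^ 2 / (16 * Real.log 2)) ∧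
      ρ ^ 2 * Real.exp (2 - 2 * ρ) * (1 - x / 7 + 5 / 441 * ρ) ≤
        279 / 500 + 23 / 50 * (8973 / 12800) * Real.exp (-Real.log ρ ^ 2 / (16 * Real.log 2)) ∧
      ρ ^ 2 * Real.exp (2 - 2 * ρ) ≤
        279 / 500 + 23 / 50 * (25071 / 25600) * Real.exp (-Real.log ρ ^ 2 / (16 * Real.log 2)) := by
  have hρ : 0 < ρ := by linarith
  set G := ρ ^ 2 * Real.exp (2 - 2 * ρ) with hG
  set E := Real.exp (-Real.log ρ ^ 2 / (16 * Real.log 2)) with hE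
  have hG0 : 0 ≤ G := by positivity
  obtain ⟨hPp, hPm, hPp0, hPm0⟩ := certHigh_Pbounds hG0 hx hxρ
  have hGB : G ≤ ρ ^ 2 * (1 + 2 * (1 - ρ) + (2 * (1 - ρ)) ^ 2 / 2 + 2 / 9 * (2 * (1 - ρ)) ^ 3) :=
    mul_le_mul_of_nonneg_left (certHigh_expB hρh hρ1) (sq_nonneg ρ)
  have hinv : ρ⁻¹ ≤ 2 := by rw [inv_le_comm₀ hρ (by norm_num)]; linarith
  have hEB : 1 - 13 / 36 * (1 - ρ) ^ 2 ≤ E := by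
    have h1 : ρ⁻¹ - 1 ≤ 2 * (1 - ρ) := by
      have : ρ⁻¹ - 1 = (1 - ρ) * ρ⁻¹ := by field_simp
      rw [this]; nlinarith
    have h2 : 0 ≤ ρ⁻¹ - 1 := by linarith [one_le_inv_iff₀.2 ⟨hρ, hρ1⟩]
    have := certHigh_Elow ((certHigh_log_sq_le_inv hρ hρ1).trans
      (show (ρ⁻¹ - 1) ^ 2 ≤ 4 * (1 - ρ) ^ 2 by nlinarith))
    linarith
  have h1 := mul_le_mul_of_nonneg_right hGB hPp0
  have h2 := mul_le_mul_of_nonneg_right hGB hPm0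
  exact ⟨by linarith only [hPp, h1, certHigh_Bp ρ hρh hρ1, hEB],
    by linarith only [hPm, h2, certHigh_Bm ρ hρh hρ1, hEB],
    by linarith only [hGB, certHigh_B0 ρ hρh hρ1, hEB]⟩

/-- Region C (`1 ≤ ρ ≤ 3`) of `helper_certHighConds`. [folklore] -/
theorem certHigh_condsC {ρ x : ℝ} (hρ1 : 1 ≤ ρ) (hρ3 : ρ ≤ 3) (hx : 0 ≤ x) (hxρ : x ^ 2 = ρ) :
    ρ ^ 2 * Real.exp (2 - 2 * ρ) * (1 + x / 7 + 5 / 441 * ρ) ≤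
        279 / 500 + 23 / 50 * (16973 / 12800) * Real.exp (-Real.log ρ ^ 2 / (16 * Real.log 2)) ∧
      ρ ^ 2 * Real.exp (2 - 2 * ρ) * (1 - x / 7 + 5 / 441 * ρ) ≤
        279 / 500 + 23 / 50 * (8973 / 12800) * Real.exp (-Real.log ρ ^ 2 / (16 * Real.log 2)) ∧
      ρ ^ 2 * Real.exp (2 - 2 * ρ) ≤
        279 / 500 + 23 / 50 * (25071 / 25600) * Real.exp (-Real.log ρ ^ 2 / (16 * Real.log 2)) := by
  have hρ : 0 < ρ := by linarith
  set G := ρ ^ 2 * Real.exp (2 - 2 * ρ) with hG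
  set E := Real.exp (-Real.log ρ ^ 2 / (16 * Real.log 2)) with hE
  have hG0 : 0 ≤ G := by positivity
  have hE0 : 0 ≤ E := (Real.exp_pos _).le
  obtain ⟨hPp, hPm, -, -⟩ := certHigh_Pbounds hG0 hx hxρ
  have hT := certHigh_expC hρ1
  have hT0 : (0 : ℝ) ≤ 1 + 2 * (ρ - 1) + (2 * (ρ - 1)) ^ 2 / 2 + (2 * (ρ - 1)) ^ 3 / 6 := by
    have : (0 : ℝ) ≤ ρ - 1 := by linarith
    positivity
  have hEC : 1 - 13 / 144 * (ρ - 1) ^ 2 ≤ E := by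
    refine certHigh_Elow ?_
    have h1 : 0 ≤ Real.log ρ := Real.log_nonneg hρ1
    have h2 : Real.log ρ ≤ ρ - 1 := Real.log_le_sub_one_of_pos hρ
    nlinarith
  have hinv : Real.exp (2 * (ρ - 1)) * Real.exp (2 - 2 * ρ) = 1 := by
    rw [← Real.exp_add, show 2 * (ρ - 1) + (2 - 2 * ρ) = 0 by ring, Real.exp_zero]
  -- from `ρ² P ≤ R · T₃` to `G P ≤ R`
  have key : ∀ {P R : ℝ}, 0 ≤ R →
      ρ ^ 2 * P ≤ R * (1 + 2 * (ρ - 1) + (2 * (ρ - 1)) ^ 2 / 2 + (2 * (ρ - 1)) ^ 3 / 6) →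
      G * P ≤ R := by
    intro P R hR h
    have h2 : ρ ^ 2 * P ≤ R * Real.exp (2 * (ρ - 1)) := h.trans (mul_le_mul_of_nonneg_left hT hR)
    calc G * P = ρ ^ 2 * P * Real.exp (2 - 2 * ρ) := by rw [hG]; ring
      _ ≤ R * Real.exp (2 * (ρ - 1)) * Real.exp (2 - 2 * ρ) :=
        mul_le_mul_of_nonneg_right h2 (Real.exp_pos _).le
      _ = R := by rw [mul_assoc, hinv, mul_one]
  refine ⟨?_, ?_, ?_⟩
  · refine hPp.trans (key (by positivity) ?_)
    rcases le_or_gt ρ 2 with hρ2 | hρ2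
    · exact (certHigh_C1p ρ hρ1 hρ2).trans (mul_le_mul_of_nonneg_right (by linarith only [hEC]) hT0)
    · exact (certHigh_C2p ρ hρ2.le hρ3).trans (mul_le_mul_of_nonneg_right (by linarith only [hEC]) hT0)
  · refine hPm.trans (key (by positivity) ?_)
    exact (certHigh_Cm ρ hρ1 hρ3).trans (mul_le_mul_of_nonneg_right (by linarith only [hEC]) hT0)
  · have := key (P := 1) (R := 279 / 500 + 23 / 50 * (25071 / 25600) * E) (by positivity)
      (by simpa using (certHigh_C0 ρ hρ1 hρ3).trans (mul_le_mul_of_nonneg_right (by linarith only [hEC]) hT0))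
    simpa using this

/-- **Registered helper sub-goal `helper_certHighConds`**: the three endpoint/centre conditions at the
extreme dipole size `b = 1/7`, for `0 < ρ ≤ 3` and `x = √ρ` (`x ≥ 0`, `x² = ρ`): with `G = ρ² e^{2−2ρ}`,
`E = exp(−(log ρ)²/(16 log 2))`, `G (1 ± x/7 + 5ρ/441) ≤ 279/500 + (23/50) Q(±1) E` and
`G ≤ 279/500 + (23/50)(Q₀ − Q₂) E`. [folklore] -/
theorem helper_certHighConds : ∀ ρ x : ℝ, 0 < ρ → ρ ≤ 3 → 0 ≤ x → x ^ 2 = ρ →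
    ρ ^ 2 * Real.exp (2 - 2 * ρ) * (1 + x / 7 + 5 / 441 * ρ) ≤
        279 / 500 + 23 / 50 * (16973 / 12800) * Real.exp (-Real.log ρ ^ 2 / (16 * Real.log 2)) ∧
      ρ ^ 2 * Real.exp (2 - 2 * ρ) * (1 - x / 7 + 5 / 441 * ρ) ≤
        279 / 500 + 23 / 50 * (8973 / 12800) * Real.exp (-Real.log ρ ^ 2 / (16 * Real.log 2)) ∧
      ρ ^ 2 * Real.exp (2 - 2 * ρ) ≤
        279 / 500 + 23 / 50 * (25071 / 25600) * Real.exp (-Real.log ρ ^ 2 / (16 * Real.log 2)) := by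
  intro ρ x hρ hρ3 hx hxρ
  rcases le_or_gt ρ (1 / 2) with h1 | h1
  · exact certHigh_condsA hρ h1 hx hxρ
  rcases le_or_gt ρ 1 with h2 | h2
  · exact certHigh_condsB h1.le h2 hx hxρ
  · exact certHigh_condsC h2.le hρ3 hx hxρ

end Summit.SmoothPoincare4.SmoothPoincare4.Theorems.CylinderEntropySliceIsolation

end
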